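import Literature.NumberTheory.EllipticCurves.IwasawaAlgebraMuVanishingProofs

/-!
# Sketch — crux idea `specialise-first-mu-x10b` (bsd-idea-16 g2, lens = decomp)

Target: stub `stub_muPartTied` (s_mu) of the pinned twins of
`PrintX10b.HowardContainmentAnyClassNumberX10b` (stmt-BirchSwinnertonDyer-23729) /
`PrintX9.HowardContainmentLightFrame` (rev-20 restatements).  Lever: Howard's own `μ`-device —
specialise the `Λ`-adic Kolyvagin system at the Eisenstein primes `q_m = (T^m + p)`
(How04, proof of Thm 2.2.10: "the case `𝔭 = pΛ` … taking `𝔮 = T^m + p`"), where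
`Λ/q_m = ℤ_p[π]`, `π^m = -p`, and read `μ` off the growth of `#(N / q_m N)` in `m`.

This file types the ALGEBRAIC TAIL of the line (pieces (E) and (L) of the card); it proves nothing
arithmetic.  BSD is not proved by any of this; no summit statement is proved by this seat.
-/

set_option linter.dupNamespace false

namespace Summit.BirchSwinnertonDyer.BirchSwinnertonDyer.Cruxes.HowardContainmentAnyClassNumberX10b.SpecialiseFirstMu

open Literature.NumberTheory.EllipticCurves IwasawaAlgebra

variable (p : ℕ) [Fact p.Prime]

/-- Howard's `μ`-specialisation polynomial `q_m = T^m + p ∈ Λ = ℤ_p⟦T⟧` (Eisenstein of degree `m`;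
`Λ/(q_m) ≅ ℤ_p[π]`, `π^m = -p`, a totally ramified DVR with residue field `𝔽_p`). -/
noncomputable def specPoly (m : ℕ) : IwasawaAlgebra p :=
  PowerSeries.X ^ m + PowerSeries.C (p : ℤ_[p])

/-- The specialised quotient `N / q_m N` of a `Λ`-module `N`. -/
abbrev SpecQuot (N : Type*) [AddCommGroup N] [Module (IwasawaAlgebra p) N] (m : ℕ) : Type _ :=
  N ⧸ (Ideal.span {specPoly p m} • (⊤ : Submodule (IwasawaAlgebra p) N))

/-- `#(N / q_m N)` (junk `0` when infinite; finite for `m ≫ 0` when `N` is f.g. torsion). -/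
noncomputable def specCard (N : Type*) [AddCommGroup N] [Module (IwasawaAlgebra p) N] (m : ℕ) : ℕ :=
  Nat.card (SpecQuot p N m)

/-- (E) Specialised-cardinality asymptotics: for a finitely generated torsion `Λ`-module `N`,
`#(N / q_m N) = p^{m·μ(N) + λ(N) + O(1)}` as `m → ∞` (Washington §13.2-type computation on the
elementary module: `Λ/(p^k, T^m+p) = ℤ_p[π]/p^k` has length `k m`; `Λ/(g, T^m+p) = ℤ_p[π]/π^{deg g}`
has length `deg g` for `m > deg g`, `g` distinguished; pseudo-isomorphism costs `O(1)`). -/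
def SpecCardAsymptotics (N : Type*) [AddCommGroup N] [Module (IwasawaAlgebra p) N] : Prop :=
  ∃ C m₀ : ℕ, ∀ m ≥ m₀,
    p ^ (m * muInvariant p N + lambdaInvariant p N) ≤ p ^ C * specCard p N m ∧
    specCard p N m ≤ p ^ C * p ^ (m * muInvariant p N + lambdaInvariant p N)

/-- (E) holds for f.g. torsion `Λ`-modules.  [structure theorem + the two quotient computations] -/
theorem specCardAsymptotics_of_isTorsion (N : Type*) [AddCommGroup N] [Module (IwasawaAlgebra p) N]
    [Module.Finite (IwasawaAlgebra p) N] (hN : Module.IsTorsion (IwasawaAlgebra p) N) :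
    SpecCardAsymptotics p N := by
  sorry

/-- **FIRST LEMMA (μ-transfer).**  A specialised Kolyvagin inequality at the primes `q_m`, uniform
in `m` up to a constant `p^C`, gives the `μ`-inequality: if `#(N/q_m N) ≤ p^C · #(N'/q_m N')²`
for all `m ≫ 0` then `μ(N) ≤ 2 μ(N')`.  (Apply (E) to both sides, divide by `m`, let `m → ∞`.)
In the line: `N = X_tors` (torsion of the Selmer dual), `N' = 𝔖/ℋ_F` (so `char N' = I(ℋ_F)`). -/
theorem mu_le_two_mu_of_specCard_le (N N' : Type*) [AddCommGroup N] [Module (IwasawaAlgebra p) N]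
    [AddCommGroup N'] [Module (IwasawaAlgebra p) N']
    [Module.Finite (IwasawaAlgebra p) N] [Module.Finite (IwasawaAlgebra p) N']
    (hN : Module.IsTorsion (IwasawaAlgebra p) N) (hN' : Module.IsTorsion (IwasawaAlgebra p) N')
    (h : ∃ C m₀ : ℕ, ∀ m ≥ m₀, specCard p N m ≤ p ^ C * specCard p N' m ^ 2) :
    muInvariant p N ≤ 2 * muInvariant p N' := by
  sorry

/-- (L) **Nilpotent-versus-scalar lemma** — the algebraic reason every local/global error module at
`q_m` has `ℤ_p`-length `O(1)` in `m`: if `N` is an `S`-linear endomorphism with `N^n = 0` (in the line: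
`N = φ - 1`, `φ` the Frobenius of the finite residue extension `k_{∞,w}/k_v`, acting on the finite
group `F_w = Ẽ(k_{∞,w})[p^∞] ⊗ S_{q_m}`) and `ε ∈ S` is a scalar (in the line: `ε = α_m(γ_v) - 1 =
π^{p^δ}·unit`, `p^δ = [Γ : Γ_v]`, valuation INDEPENDENT of `m`), then `ker (N - ε) ⊆ F[ε^n]`.
Hence `#ker ≤ #F[π^{n p^δ}] ≤ p^{n p^δ r}` (`r` = number of generators of `F_w`), a constant. -/
theorem ker_sub_scalar_le_torsionBy {S F : Type*} [CommRing S] [AddCommGroup F] [Module S F]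
    (N : F →ₗ[S] F) (n : ℕ) (hN : N ^ n = 0) (ε : S) :
    LinearMap.ker (N - ε • LinearMap.id) ≤ Submodule.torsionBy S F (ε ^ n) := by
  intro x hx
  rw [LinearMap.mem_ker, LinearMap.sub_apply, LinearMap.smul_apply, LinearMap.id_apply,
    sub_eq_zero] at hx
  have key : ∀ k : ℕ, (N ^ k) x = ε ^ k • x := by
    intro k
    induction k with
    | zero => simp
    | succ k ih =>
      rw [pow_succ', Module.End.mul_apply, ih, map_smul, hx, smul_smul, pow_succ', mul_comm]
  have hn := key n
  rw [hN, LinearMap.zero_apply] at hn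
  exact (Submodule.mem_torsionBy_iff _ _).2 hn.symm

/-- Cancelling a prime power against a coprime divisor (private copy of the helper landed with
p614273 in `IwasawaAlgebraMuPromotionProofs.lean`; inlined so this sketch checks on a farm snapshot
that predates that module). -/
private theorem dvd_of_dvd_prime_pow_mul' {R : Type*} [CommMonoidWithZero R] [IsCancelMulZero R]
    {π d z : R} (hπ : Prime π) (hd : ¬ π ∣ d) : ∀ (n : ℕ), d ∣ π ^ n * z → d ∣ z
  | 0, h => by simpa using h
  | n + 1, h => by
    have h' : d ∣ π ^ n * (π * z) := by rwa [← mul_assoc, ← pow_succ]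
    obtain ⟨w, hw⟩ := dvd_of_dvd_prime_pow_mul' hπ hd n h'
    have hdw : π ∣ d * w := ⟨z, hw.symm⟩
    rcases hπ.dvd_or_dvd hdw with h1 | ⟨w', rfl⟩
    · exact absurd h1 hd
    · refine ⟨w', mul_left_cancel₀ hπ.ne_zero ?_⟩
      rw [hw, mul_left_comm]

/-- **(P) — PROVED; = tree theorem
`Literature.NumberTheory.EllipticCurves.IwasawaAlgebra.sq_charIdeal_le_charIdeal_of_span_p_pow_mul_le_of_muInvariant_le`
(p614273, `IwasawaAlgebraMuPromotionProofs.lean`; `lengthAt`-currency twins appended by p615179).**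
The promotion step: `(p^k)·char(N')² ≤ char(N)` and `μ(N) ≤ 2 μ(N')` give `char(N')² ≤ char(N)`.
Proof (Washington §13.2): structure theorem ⟹ `char N = (p^a D)`, `char N' = (p^b D')`, `p ∤ D`,
`a = μ(N) ≤ 2b = 2μ(N')`; cancel `p` against `D`. -/
theorem sq_charIdeal_le_charIdeal_of_localized_of_mu_le (N N' : Type*)
    [AddCommGroup N] [Module (IwasawaAlgebra p) N] [AddCommGroup N'] [Module (IwasawaAlgebra p) N']
    [Module.Finite (IwasawaAlgebra p) N] [Module.Finite (IwasawaAlgebra p) N']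
    (hN : Module.IsTorsion (IwasawaAlgebra p) N) (hN' : Module.IsTorsion (IwasawaAlgebra p) N') (k : ℕ)
    (hloc : Ideal.span {(p : IwasawaAlgebra p) ^ k} * Module.charIdeal (IwasawaAlgebra p) N' ^ 2 ≤
      Module.charIdeal (IwasawaAlgebra p) N)
    (hμ : muInvariant p N ≤ 2 * muInvariant p N') :
    Module.charIdeal (IwasawaAlgebra p) N' ^ 2 ≤ Module.charIdeal (IwasawaAlgebra p) N := by
  obtain ⟨μs, fs, -, hfs, hψ⟩ := exists_isPseudoIsomorphism_elementary_holds p N hN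
  obtain ⟨νs, gs, -, hgs, hφ⟩ := exists_isPseudoIsomorphism_elementary_holds p N' hN'
  have hfs' : ∀ f ∈ fs, f.1.IsDistinguishedAt (IsLocalRing.maximalIdeal ℤ_[p]) :=
    fun f hf => (hfs f hf).1
  have hgs' : ∀ g ∈ gs, g.1.IsDistinguishedAt (IsLocalRing.maximalIdeal ℤ_[p]) :=
    fun g hg => (hgs g hg).1
  have hcX := charIdeal_eq_span_holds p N hfs' hψ
  have hcY := charIdeal_eq_span_holds p N' hgs' hφ
  have hD0 : ¬ PowerSeries.C (p : ℤ_[p]) ∣ (fs.map fun f => (f.1 : IwasawaAlgebra p) ^ f.2).prod := by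
    intro h
    have h' : PowerSeries.C (p : ℤ_[p]) ∣ charElement p [] fs := by simpa [charElement] using h
    exact ((C_dvd_charElement_iff (μs := ([] : List ℕ)) hfs').mp h') (by simp)
  have hE : ∀ (μs : List ℕ) (fs : List (Polynomial ℤ_[p] × ℕ)), charElement p μs fs =
      PowerSeries.C (p : ℤ_[p]) ^ μs.sum * (fs.map fun f => (f.1 : IwasawaAlgebra p) ^ f.2).prod :=
    fun μs fs => by rw [charElement, map_pow]
  rw [muInvariant_eq_sum_holds p N hfs' hψ, muInvariant_eq_sum_holds p N' hgs' hφ] at hμ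
  rw [hcX, hcY, Ideal.span_singleton_pow, Ideal.span_singleton_mul_span_singleton,
    Ideal.span_singleton_le_span_singleton, hE, hE, ← map_natCast (PowerSeries.C (R := ℤ_[p])) p]
    at hloc
  rw [hcX, hcY, Ideal.span_singleton_pow, Ideal.span_singleton_le_span_singleton, hE, hE]
  rw [mul_pow, ← pow_mul, mul_comm νs.sum 2] at hloc ⊢
  have hD : (fs.map fun f => (f.1 : IwasawaAlgebra p) ^ f.2).prod ∣
      (gs.map fun f => (f.1 : IwasawaAlgebra p) ^ f.2).prod ^ 2 := by
    refine dvd_of_dvd_prime_pow_mul' (prime_C p) hD0 (k + 2 * νs.sum) ?_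
    rw [pow_add, mul_assoc]
    exact dvd_of_mul_left_dvd hloc
  exact mul_dvd_mul (pow_dvd_pow _ hμ) hD

end Summit.BirchSwinnertonDyer.BirchSwinnertonDyer.Cruxes.HowardContainmentAnyClassNumberX10b.SpecialiseFirstMu
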